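import Summits.ResolutionOfSingularities.ResolutionOfSingularities.Theorems.HomologicalConductorNoZenoSplitExcCount
import Literature.AlgebraicGeometry.Resolution.ExceptionalPointsFinite
import Literature.AlgebraicGeometry.Resolution.ExceptionalCurvePoints
import HarnessLib

/-!
# Crux `NoZenoR` (stmt-ResolutionOfSingularities-19943), β layer — toward `sepNodes_finite` (PREP v2.1 §2.1 D2), piece (iii):
# two DISTINCT integral exceptional curves of a proper `X → Spec R` meet in finitely many points

Route `ResolutionOfSingularities/HomologicalConductor`, crux chain W4.4.  OURS (cell res-hironaka; planner res-L0-w44-plan-1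
CHAIN v24 §2 «`sepNodes_finite`» — this file is the topological third of its decomposition sepNodes ⊆ ⋃_η NonNormal(cl η) ∪
⋃_{η ≠ η′} (cl η ∩ cl η′): the pairwise intersections are finite; the non-normal-locus piece and the one-branch-at-a-regular-point
piece are NOT here); AI-written, weaker than expert review; nothing of the manuscript under review (Hironaka 2017) is used.
Def-free, `--supports 19943 --as helper`.

* `finite_closure_inter_closure_of_height_le_one` — in a Noetherian scheme, two DISTINCT points `η ≠ η′` of height `≤ 1`
  (closed points or generic points of curves, in the specialisation order `x ≤ y ↔ y ⤳ x` used by `excCurvePoints`) have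
  `closure {η} ∩ closure {η′}` FINITE: every point of the intersection is a maximal point of it (a proper specialisation
  `w ⤳ z` inside it would give a chain `z < w < η` or `z < η < η′` of length `2` below a point of height `≤ 1`), and a closed
  subset of a Noetherian scheme has finitely many maximal points (tree `maxPoints_finite`, Stacks 0BA8).
* `finite_closure_inter_closure_of_mem_excCurvePoints` — the case of two distinct integral exceptional curves
  `η, η′ ∈ excCurvePoints π` (height `1` by definition) of a proper `π : X → Spec R`, `R` Noetherian local (`X` is then
  Noetherian).

References: The Stacks Project, Tag 0BA8 [`StacksProject`]; J. Lipman, Publ. IHÉS 36 (1969) §13 Prop. (13.1) c) p. 223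
(distinct integral exceptional curves meet in a finite set — context) [`Lipman1969`].
-/

-- single-problem summit: the doubled namespace component `ResolutionOfSingularities` is forced
set_option linter.dupNamespace false

noncomputable section

namespace Summit.ResolutionOfSingularities.ResolutionOfSingularities.Theorems.NoZeno.ExcCount

open CategoryTheory AlgebraicGeometry TopologicalSpace IsLocalRing
open Literature.AlgebraicGeometry.Resolution

universe u

/-- In the specialisation order of a scheme (`x ≤ y ↔ y ⤳ x`, Mathlib `Scheme.le_iff_specializes`), a proper
specialisation is strictly smaller (schemes are `T₀`). [folklore] -/
private theorem lt_of_specializes_of_ne'' {X : Scheme.{u}} {x y : X} (h : y ⤳ x) (hne : x ≠ y) : x < y :=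
  ⟨Scheme.le_iff_specializes.2 h, fun h' => hne ((Scheme.le_iff_specializes.1 h').antisymm h).eq⟩

/-- `(1 : ℕ∞) + 1 ≤ 1` is false. [folklore] -/
private theorem not_one_add_one_le_one : ¬ ((1 : ℕ∞) + 1 ≤ 1) := by decide

/-- **Two distinct points of height `≤ 1` of a Noetherian scheme have finitely many common specialisations**: for
`η ≠ η′` with `Order.height η ≤ 1`, `Order.height η′ ≤ 1` (specialisation order `x ≤ y ↔ y ⤳ x`), the closed set
`closure {η} ∩ closure {η′}` is finite — each of its points is one of its maximal points (no proper specialisation inside: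
a chain `z < w ≤ η`, `w ∈ closure {η′}`, forces height `≥ 2` at `η` or at `η′`), and a closed subset of a Noetherian
scheme has finitely many maximal points (`maxPoints_finite`). [cite: StacksProject, Tag 0BA8] -/
theorem finite_closure_inter_closure_of_height_le_one {X : Scheme.{u}} [IsNoetherian X] {η η' : X}
    (hη : Order.height η ≤ 1) (hη' : Order.height η' ≤ 1) (hne : η ≠ η') :
    (closure ({η} : Set X) ∩ closure {η'}).Finite := by
  have hZc : IsClosed (closure ({η} : Set X) ∩ closure {η'}) := isClosed_closure.inter isClosed_closure
  refine (maxPoints_finite hZc).subset fun z hz => ?_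
  refine mem_maxPoints_iff.2 ⟨hz, fun w hw hwz => ?_⟩
  by_contra hwne
  -- `z < w` in the specialisation order
  have hzw : z < w := lt_of_specializes_of_ne'' hwz (fun h => hwne h.symm)
  have hηw : η ⤳ w := specializes_iff_mem_closure.2 hw.1
  have hη'w : η' ⤳ w := specializes_iff_mem_closure.2 hw.2
  have h1 : Order.height z + 1 ≤ Order.height w := Order.height_add_one_le hzw
  have h1' : (1 : ℕ∞) + 1 ≤ Order.height w + 1 := by
    gcongr
    exact le_trans le_add_self h1
  by_cases hwη : w = η
  · -- then `η ∈ closure {η'}` with `η ≠ η'`: `η < η'`, so `height η + 1 ≤ height η' ≤ 1`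
    subst hwη
    have hlt : w < η' := lt_of_specializes_of_ne'' hη'w hne
    have h2 : Order.height w + 1 ≤ Order.height η' := Order.height_add_one_le hlt
    exact not_one_add_one_le_one (h1'.trans (h2.trans hη'))
  · -- else `z < w < η`, so `height z + 2 ≤ height η ≤ 1`
    have hlt : w < η := lt_of_specializes_of_ne'' hηw hwη
    have h2 : Order.height w + 1 ≤ Order.height η := Order.height_add_one_le hlt
    exact not_one_add_one_le_one (h1'.trans (h2.trans hη))

/-- **Two distinct integral exceptional curves of a proper `π : X → Spec R` (`R` Noetherian local) meet in finitely many
points**: for `η ≠ η′` in `excCurvePoints π` (points over the closed point of height `1`), `closure {η} ∩ closure {η′}` is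
finite (`finite_closure_inter_closure_of_height_le_one`; `X` is Noetherian, being of finite type over the Noetherian `R`).
This is piece (iii) of `sepNodes π ⊆ ⋃ NonNormal(E_η) ∪ ⋃_{η≠η′} (E_η ∩ E_η′)` toward `sepNodes_finite`; cf. Lipman,
Prop. (13.1) c): distinct integral exceptional curves have finite intersection. [cite: Lipman1969, Proposition (13.1) c) (p. 223)] -/
theorem finite_closure_inter_closure_of_mem_excCurvePoints {R : Type u} [CommRing R] [IsLocalRing R]
    [IsNoetherianRing R] {X : Scheme.{u}} (π : X ⟶ Spec (.of R)) [IsProper π] {η η' : X}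
    (hη : η ∈ excCurvePoints π) (hη' : η' ∈ excCurvePoints π) (hne : η ≠ η') :
    (closure ({η} : Set X) ∩ closure {η'}).Finite := by
  haveI : IsNoetherian X := by
    haveI : IsLocallyNoetherian X := LocallyOfFiniteType.isLocallyNoetherian π
    haveI : CompactSpace X := QuasiCompact.compactSpace_of_compactSpace π
    exact {}
  exact finite_closure_inter_closure_of_height_le_one hη.2.le hη'.2.le hne

end Summit.ResolutionOfSingularities.ResolutionOfSingularities.Theorems.NoZeno.ExcCount

end
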